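import Summits.MatrixMultiplication.MatrixMultiplication.Theorems.FarEdgeDescentSpectralEdge
import HarnessLib

/-!
# Route `FarEdgeDescent` on Strassen's asymptotic spectrum, II: roofs, edge rigidity, dark points (`ℂ`)

Support module (def-free) for the special crux `FiniteSaturation` (stmt-MatrixMultiplication-23739);
continues `FarEdgeDescentSpectralEdge` (the dictionary `2^{ω(a,b,c)} = max_φ φ⟨2^a,2^b,2^c⟩`, roofs,
`φ⟨2,2,2⟩ ≥ 4`, the light point `ζ⁽²⁾`).  Write `roof k` for "`φ⟨2,2^k,2⟩ ≤ 2^{k+1}` for every universal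
spectral point over `ℂ`" (spelled out in each statement; no definition is introduced).

* **Route items on the spectrum.** `FiniteSaturation ⟺ ∃ k ≥ 2, roof k` (`finiteSaturation_iff_roof`);
  the summit is the square roof `φ⟨2,2,2⟩ ≤ 4` on `X(ℂ)` (`mm_iff_squareRoof`); the `k = ∞` rung —
  EDGE RIGIDITY `v = 2 ⟹ u·w = 2` (Alman–Li–Pratt 2026, Prop. 8.1) — is a THEOREM over `ℂ`
  (`edge_rigidity`, from the landed `LogRate`, item 25370), with the explicit modulus
  `φ⟨2,2^k,2⟩ ≤ 2^{k+1+log 2/log(2k+2)}` (`far_logModulus`).  Ladder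
  `roof 1 (= S) ⟸? roof 2 ⟸? roof 3 ⟸? … ⟸ roof ∞ (proved)`: the special crux says "some finite rung
  holds", the generic law `AnchoredLogConvexity` is the descent engine `roof (2k+1) ⟹ roof (k+1)`
  (`alc_roof_descent`), and the residual `FiniteSaturation → S` reads "a finite rung forces the square
  roof" (`residual_iff`).
* **Round (generic) side.** `¬ FiniteSaturation ⟺` every finite roof is pierced by some spectral point
  (`not_finiteSaturation_iff_bulge`); a point carrying an unsaturated far direction is DARK (`v < 2`,
  `carrier_off_edge`) and dark points accumulate at the edge (`darkPoints_accumulate`), while an edge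
  point carries exactly the saturated directions (`edge_point_carries_iff_saturated`): the dichotomy of
  record reads "some far direction `(1,k,1)`, `k ≥ 2`, has a LIGHT carrier (special:
  `finiteSaturation_iff_light_carrier`) or all far carriers are dark (generic)".

Placement [cite: AlmanLiPratt2026, Prop. 8.1, Cor. 8.4] [cite: AlmanLi2026, Proposition 4.2]
[cite: LottiRomani1983, Prop. 4.1] [cite: Coppersmith1982, Thm. 1].
Written by the decomp-mm lens-2 planner seat (gen 12); no new definitions.
-/

set_option linter.dupNamespace false

noncomputable section

namespace Summit.MatrixMultiplication.MatrixMultiplication.Theorems.FarEdgeDescentSpectralRoof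

open Literature.Computability.AlgebraicComplexity
open Summit.MatrixMultiplication.MatrixMultiplication.Theses.FarEdgeDescent
open Summit.MatrixMultiplication.MatrixMultiplication.Theorems.FarEdgeDescentChord
open Summit.MatrixMultiplication.MatrixMultiplication.Theorems.FarEdgeDescentTameProfile
open Summit.MatrixMultiplication.MatrixMultiplication.Theorems.FarEdgeDescentSpectralEdge

/-! ## §1 The route items on the spectrum `X(ℂ)` -/

/-- **`FiniteSaturation ⟺ ∃ k ≥ 2, roof k`**: the special crux (stmt-MatrixMultiplication-23739) says
that for some finite `k ≥ 2` every universal spectral point over `ℂ` has `φ⟨2,2^k,2⟩ ≤ 2^{k+1}`.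
[cite: LottiRomani1983, Prop. 4.1] -/
theorem finiteSaturation_iff_roof :
    FiniteSaturation ↔ ∃ k : ℕ, 2 ≤ k ∧ ∀ F : SpectralMap ℂ, IsUniversalSpectralPoint ℂ F →
      F (matMulTensor ℂ 2 (2 ^ k) 2) ≤ (2 : ℝ) ^ ((k : ℝ) + 1) := by
  refine exists_congr fun k => and_congr Iff.rfl ?_
  exact (roof_iff_saturated (K := ℂ) k).symm

/-- **The summit is the square roof**: `ω(ℂ) = 2 ⟺ φ⟨2,2,2⟩ ≤ 4` for every universal spectral point
(then `= 4`, by `four_le_map_cube`). [cite: AlmanLi2026, Proposition 4.2] -/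
theorem mm_iff_squareRoof :
    _root_.MatrixMultiplication ↔
      ∀ F : SpectralMap ℂ, IsUniversalSpectralPoint ℂ F → F (matMulTensor ℂ 2 2 2) ≤ 4 := by
  rw [_root_.MatrixMultiplication_iff]
  have hR : asymptoticRank (matMulTensor ℂ 2 2 2) = (2 : ℝ) ^ omega ℂ := by
    rw [asymptoticRank_matMulTensor ℂ 2 (by norm_num), Nat.cast_ofNat]
  have hD := strassen_duality_asymptoticRank_holds ℂ (matMulTensor ℂ 2 2 2)
  constructor
  · intro hω F hF
    have h := (hD.1 F hF).trans_eq hR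
    rw [hω, Real.rpow_two] at h
    norm_num at h
    exact h
  · intro h
    obtain ⟨F, hF, hFt⟩ := hD.2
    have h4 : (2 : ℝ) ^ omega ℂ ≤ (2 : ℝ) ^ (2 : ℝ) := by
      rw [← hR, ← hFt, Real.rpow_two]
      norm_num
      exact h F hF
    have hle := (Real.rpow_le_rpow_left_iff one_lt_two).1 h4
    have hge := two_le_omegaRect_one_mid_one ℂ 1
    rw [omegaRect_one_one_one] at hge
    exact le_antisymm hle hge

/-- **Edge rigidity** (Alman–Li–Pratt 2026, Prop. 8.1; here over `ℂ` from Lotti–Romani's `e(k) → 0`, the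
landed `LogRate`): a universal spectral point with `v = φ⟨1,2,1⟩ = 2` has `u·w = φ⟨2,1,2⟩ = 2` — the
`k = ∞` rung of the roof ladder is a theorem. [cite: AlmanLiPratt2026, Prop. 8.1]
[cite: LottiRomani1983, Prop. 4.1] -/
theorem edge_rigidity {F : SpectralMap ℂ} (hF : IsUniversalSpectralPoint ℂ F)
    (hv : F (matMulTensor ℂ 1 2 1) = 2) : F (matMulTensor ℂ 2 1 2) = 2 := by
  set s := F (matMulTensor ℂ 2 1 2) with hs_def
  have hfar : ∀ k : ℕ, F (matMulTensor ℂ 2 (2 ^ k) 2) = s * 2 ^ k := by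
    intro k
    rw [map_far_eq hF k, hv]
  have hs1 : 1 ≤ s := one_le_map hF (by norm_num) le_rfl (by norm_num)
  have hspos : 0 < s := by linarith
  -- lower bound `s ≥ 2`: `2 s = φ⟨2,2,2⟩ ≥ 4`
  have hge : 2 ≤ s := by
    have h4 := four_le_map_cube hF
    rw [← SpectralMap.map_matMulTensor_congr F rfl (pow_one 2) rfl, hfar 1] at h4
    linarith
  -- upper bound `s ≤ 2`: `s 2^k = φ⟨2,2^k,2⟩ ≤ 2^{ω(1,k,1)}` and `ω(1,k,1) − (k+1) → 0`
  have hL : Real.logb 2 s ≤ 1 := by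
    refine le_of_forall_pos_lt_add fun ε hε => ?_
    obtain ⟨k, -, -, hk⟩ := exists_nat_excess_lt hε 0
    have h := map_far_le hF k
    rw [hfar k] at h
    have e : (2 : ℝ) ^ (Real.logb 2 s + k) = s * 2 ^ k := by
      rw [Real.rpow_add two_pos, Real.rpow_logb two_pos (by norm_num) hspos, Real.rpow_natCast]
    rw [← e] at h
    have h' := (Real.rpow_le_rpow_left_iff one_lt_two).1 h
    linarith
  have hle : s ≤ 2 := by
    have h := (Real.logb_le_iff_le_rpow one_lt_two hspos).1 hL
    rwa [Real.rpow_one] at h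
  exact le_antisymm hle hge

/-- **Modulus of edge rigidity**: `φ⟨2,2^k,2⟩ ≤ 2^{k+1+log 2/log(2k+2)}` for every `k ≥ 1` and every
universal spectral point — the landed `LogRate` (Coppersmith at the far edge) read on the spectrum.
[cite: Coppersmith1982, Thm. 1] -/
theorem far_logModulus {F : SpectralMap ℂ} (hF : IsUniversalSpectralPoint ℂ F) {k : ℕ} (hk : 1 ≤ k) :
    F (matMulTensor ℂ 2 (2 ^ k) 2) ≤ (2 : ℝ) ^ ((k : ℝ) + 1 + Real.log 2 / Real.log (2 * k + 2)) :=
  (map_far_le hF k).trans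
    (Real.rpow_le_rpow_of_exponent_le one_le_two (FarEdgeDescentLogRate.logRate k hk))

/-- **The generic law as descent engine**: under `AnchoredLogConvexity`, `roof (2k+1) ⟹ roof (k+1)`
(`k ≥ 1`; the halving step of `FarEdgeDescentChord` on the spectrum). -/
theorem alc_roof_descent (hA : AnchoredLogConvexity) {k : ℕ} (hk : 1 ≤ k)
    (h : ∀ F : SpectralMap ℂ, IsUniversalSpectralPoint ℂ F →
      F (matMulTensor ℂ 2 (2 ^ (2 * k + 1)) 2) ≤ (2 : ℝ) ^ (((2 * k + 1 : ℕ) : ℝ) + 1)) :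
    ∀ F : SpectralMap ℂ, IsUniversalSpectralPoint ℂ F →
      F (matMulTensor ℂ 2 (2 ^ (k + 1)) 2) ≤ (2 : ℝ) ^ (((k + 1 : ℕ) : ℝ) + 1) := by
  rw [roof_iff_saturated] at h ⊢
  push_cast at h ⊢
  have hk1 : (1 : ℝ) < 2 * k + 1 := by
    have : (1 : ℝ) ≤ k := by exact_mod_cast hk
    linarith
  have hs := halving_step hA hk1 h
  have e : ((2 : ℝ) * k + 1 + 1) / 2 = k + 1 := by ring
  rwa [e] at hs

/-- **The residual on the spectrum**: `FiniteSaturation → ω = 2` says "a roof of some finite slope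
`k ≥ 2` forces the square roof `φ⟨2,2,2⟩ ≤ 4`". -/
theorem residual_iff :
    (FiniteSaturation → _root_.MatrixMultiplication) ↔
      ((∃ k : ℕ, 2 ≤ k ∧ ∀ F : SpectralMap ℂ, IsUniversalSpectralPoint ℂ F →
          F (matMulTensor ℂ 2 (2 ^ k) 2) ≤ (2 : ℝ) ^ ((k : ℝ) + 1)) →
        ∀ F : SpectralMap ℂ, IsUniversalSpectralPoint ℂ F → F (matMulTensor ℂ 2 2 2) ≤ 4) := by
  rw [finiteSaturation_iff_roof, mm_iff_squareRoof]

/-! ## §2 The round side: dark points -/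

/-- **`¬ FiniteSaturation ⟺` every finite roof is pierced**: for each `k ≥ 2` some universal spectral
point has `φ⟨2,2^k,2⟩ > 2^{k+1}`. -/
theorem not_finiteSaturation_iff_bulge :
    ¬ FiniteSaturation ↔ ∀ k : ℕ, 2 ≤ k → ∃ F : SpectralMap ℂ, IsUniversalSpectralPoint ℂ F ∧
      (2 : ℝ) ^ ((k : ℝ) + 1) < F (matMulTensor ℂ 2 (2 ^ k) 2) := by
  rw [finiteSaturation_iff_roof]
  constructor
  · intro h k hk
    by_contra hc
    push Not at hc
    exact h ⟨k, hk, hc⟩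
  · rintro h ⟨k, hk, hroof⟩
    obtain ⟨F, hF, hlt⟩ := h k hk
    exact lt_irrefl _ (lt_of_lt_of_le hlt (hroof F hF))

/-- **Dark carriers**: if `(1,k,1)` is NOT saturated, every spectral point carrying `2^{ω(1,k,1)}` is
strictly off the edge (`v < 2`) — an edge point only reaches `2^{k+1}`, by edge rigidity. -/
theorem carrier_off_edge {k : ℕ} (hk : omegaRect ℂ 1 k 1 ≠ k + 1) {F : SpectralMap ℂ}
    (hF : IsUniversalSpectralPoint ℂ F)
    (hmax : F (matMulTensor ℂ 2 (2 ^ k) 2) = (2 : ℝ) ^ omegaRect ℂ 1 k 1) :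
    F (matMulTensor ℂ 1 2 1) < 2 := by
  have hv2 : F (matMulTensor ℂ 1 2 1) ≤ 2 := by
    have h' := map_le_card hF 1 2 1
    norm_num at h'
    exact h'
  refine lt_of_le_of_ne hv2 fun hv => hk ?_
  have hs := edge_rigidity hF hv
  rw [map_far_eq hF k, hs, hv] at hmax
  have e : (2 : ℝ) * 2 ^ k = (2 : ℝ) ^ ((k : ℝ) + 1) := by
    rw [Real.rpow_add two_pos, Real.rpow_natCast, Real.rpow_one]; ring
  rw [e] at hmax
  exact le_antisymm ((Real.rpow_le_rpow_left_iff one_lt_two).1 hmax.ge)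
    (add_one_le_omegaRect_one_mid_one ℂ k)

/-- **Dark points accumulate at the edge**: if no shape is saturated, the spectrum has points with
`2^{1−δ} < v < 2` for every `δ > 0` (the round world: `X` leaves the edge tangentially). -/
theorem darkPoints_accumulate (h : ¬ FiniteSaturation) {δ : ℝ} (hδ : 0 < δ) :
    ∃ F : SpectralMap ℂ, IsUniversalSpectralPoint ℂ F ∧ F (matMulTensor ℂ 1 2 1) < 2 ∧
      (2 : ℝ) ^ (1 - δ) < F (matMulTensor ℂ 1 2 1) := by
  rw [not_finiteSaturation_iff_bulge] at h
  obtain ⟨k, hk⟩ := exists_nat_ge (max 2 (1 / δ))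
  have hk2 : (2 : ℝ) ≤ k := le_trans (le_max_left _ _) hk
  have hkδ : 1 / δ ≤ k := le_trans (le_max_right _ _) hk
  have hkpos : (0 : ℝ) < k := by linarith
  obtain ⟨F, hF, hlt⟩ := h k (by exact_mod_cast hk2)
  have hv0 : 0 ≤ F (matMulTensor ℂ 1 2 1) := hF.nonneg _
  have hv2 : F (matMulTensor ℂ 1 2 1) ≤ 2 := by
    have h' := map_le_card hF 1 2 1
    norm_num at h'
    exact h'
  have hs4 : F (matMulTensor ℂ 2 1 2) ≤ 4 := by
    have h' := map_le_card hF 2 1 2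
    norm_num at h'
    exact h'
  rw [map_far_eq hF k] at hlt
  refine ⟨F, hF, ?_, ?_⟩
  · refine lt_of_le_of_ne hv2 fun hv => ?_
    have hs := edge_rigidity hF hv
    rw [hs, hv] at hlt
    have e : (2 : ℝ) * 2 ^ k = (2 : ℝ) ^ ((k : ℝ) + 1) := by
      rw [Real.rpow_add two_pos, Real.rpow_natCast, Real.rpow_one]; ring
    rw [e] at hlt
    exact lt_irrefl _ hlt
  · have h4 : (2 : ℝ) ^ ((k : ℝ) + 1) = 4 * (2 : ℝ) ^ ((k : ℝ) - 1) := by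
      rw [show (k : ℝ) + 1 = 2 + ((k : ℝ) - 1) by ring, Real.rpow_add two_pos, Real.rpow_two]
      norm_num
    rw [h4] at hlt
    have hsv : F (matMulTensor ℂ 2 1 2) * F (matMulTensor ℂ 1 2 1) ^ k ≤
        4 * F (matMulTensor ℂ 1 2 1) ^ k := mul_le_mul_of_nonneg_right hs4 (pow_nonneg hv0 k)
    have hvk : (2 : ℝ) ^ ((k : ℝ) - 1) < F (matMulTensor ℂ 1 2 1) ^ k := by linarith
    have hroot : ((2 : ℝ) ^ ((k : ℝ) - 1)) ^ (1 / (k : ℝ)) <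
        (F (matMulTensor ℂ 1 2 1) ^ k) ^ (1 / (k : ℝ)) :=
      Real.rpow_lt_rpow (by positivity) hvk (by positivity)
    rw [← Real.rpow_natCast (F (matMulTensor ℂ 1 2 1)) k, ← Real.rpow_mul hv0,
      ← Real.rpow_mul two_pos.le, mul_one_div_cancel hkpos.ne', Real.rpow_one] at hroot
    have hexp : 1 - δ ≤ ((k : ℝ) - 1) * (1 / k) := by
      rw [sub_mul, one_mul, mul_one_div_cancel hkpos.ne']
      have : 1 / (k : ℝ) ≤ δ := (one_div_le hkpos hδ).2 hkδ
      linarith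
    calc (2 : ℝ) ^ (1 - δ) ≤ 2 ^ (((k : ℝ) - 1) * (1 / k)) :=
          Real.rpow_le_rpow_of_exponent_le one_le_two hexp
      _ < F (matMulTensor ℂ 1 2 1) := hroot


/-! ## §3 Light versus dark carriers -/

/-- **An edge point carries `(1,k,1)` iff `(1,k,1)` is saturated** (over `ℂ`): on the edge the far
values are exactly `2^{k+1}` by edge rigidity. [cite: AlmanLiPratt2026, Prop. 8.1] -/
theorem edge_point_carries_iff_saturated {F : SpectralMap ℂ} (hF : IsUniversalSpectralPoint ℂ F)
    (hv : F (matMulTensor ℂ 1 2 1) = 2) (k : ℕ) :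
    F (matMulTensor ℂ 2 (2 ^ k) 2) = (2 : ℝ) ^ omegaRect ℂ 1 k 1 ↔ omegaRect ℂ 1 k 1 = k + 1 := by
  have hval : F (matMulTensor ℂ 2 (2 ^ k) 2) = (2 : ℝ) ^ ((k : ℝ) + 1) := by
    rw [map_far_eq hF k, edge_rigidity hF hv, hv, Real.rpow_add two_pos, Real.rpow_natCast,
      Real.rpow_one]
    ring
  rw [hval]
  constructor
  · intro h
    exact le_antisymm ((Real.rpow_le_rpow_left_iff one_lt_two).1 h.ge)
      (add_one_le_omegaRect_one_mid_one ℂ k)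
  · intro hs
    rw [hs]

/-- **Light/dark dichotomy of the far directions** (over `ℂ`): `(1,k,1)` is saturated iff its maximum
`2^{ω(1,k,1)}` is carried by a point ON the edge `v = 2` (light); otherwise all its carriers are dark
(`carrier_off_edge`).  `FiniteSaturation` = "some `k ≥ 2` has a light carrier". -/
theorem saturated_iff_carried_on_edge (k : ℕ) :
    omegaRect ℂ 1 k 1 = k + 1 ↔ ∃ F : SpectralMap ℂ, IsUniversalSpectralPoint ℂ F ∧
      F (matMulTensor ℂ 1 2 1) = 2 ∧ F (matMulTensor ℂ 2 (2 ^ k) 2) = (2 : ℝ) ^ omegaRect ℂ 1 k 1 := by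
  constructor
  · intro hs
    obtain ⟨F, hF, hv⟩ := exists_edge_point (K := ℂ)
    exact ⟨F, hF, hv, (edge_point_carries_iff_saturated hF hv k).2 hs⟩
  · rintro ⟨F, hF, hv, hmax⟩
    exact (edge_point_carries_iff_saturated hF hv k).1 hmax

/-- `FiniteSaturation ⟺` some far direction `(1,k,1)`, `k ≥ 2`, has a LIGHT carrier. -/
theorem finiteSaturation_iff_light_carrier :
    FiniteSaturation ↔ ∃ k : ℕ, 2 ≤ k ∧ ∃ F : SpectralMap ℂ, IsUniversalSpectralPoint ℂ F ∧
      F (matMulTensor ℂ 1 2 1) = 2 ∧ F (matMulTensor ℂ 2 (2 ^ k) 2) = (2 : ℝ) ^ omegaRect ℂ 1 k 1 :=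
  exists_congr fun k => and_congr Iff.rfl (saturated_iff_carried_on_edge k)

end Summit.MatrixMultiplication.MatrixMultiplication.Theorems.FarEdgeDescentSpectralRoof

end
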